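import Mathlib
import HarnessLib
import Summits.ValiantsHypothesis.ValiantsHypothesis.Theses.MonotoneRestoration
import Literature.Computability.AlgebraicComplexity.ArithCircuit
import Literature.ModelTheory.FiniteModelTheory.CkEquiv

/-!
# Strategy census — typed statements (crux `MonotoneRestorationQP`, strategist 2026-08-17)

Companion of `STRATEGY-CENSUS.md` (crux item `stmt-ValiantsHypothesis-15886`). Sorry-free; only
definitions of the census statements and the trivial implications between them, so that the
census entries are TYPED over the tree's declarations. Nothing here is registered as a line; the
registered line is `Lines/interval-blocks.lean`.

* `IsIntervalBlock` — the gate predicate of the registered line (a polynomial on the `n × n`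
  matrix invariant under colour-preserving row and column permutations for monotone colourings
  with `B` colours = Young subgroups of ≤ `B` INTERVAL blocks on each side).
* D2 / N1 — the FOOLING HINGE: `Fooling` (monotone-easy matrix-symmetric nonnegative polynomials
  do not separate `C^{polylog}`-equivalent graphs at their adjacency matrices) and
  `FooledRestoration` (the crux relativised to fooled families); `fooling_hinge` is the trivial
  composition. NOT registered as a line: the second half is the crux in costume. `Fooling` is the
  typed NEGATION TARGET (a monotone-easy separating family refutes it and — through the support
  theorem at polylog scale — the crux).
* S3 — the strengthening to CANCELLATION-FREE symmetric circuits, `MonotoneSymmetricRestorationQP`,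
  with its refutation witness `esymmRowSums` (`e_{⌊n/2⌋}` of the row sums: monotone `O(n²)`,
  symmetric `O(n²)` WITH subtraction; WITHOUT subtraction every square-symmetric circuit has orbit
  size `2^{Ω(n)}` — paper proof in STRATEGY-CENSUS.md §S3: support theorem + row purity of
  cancellation-free products; not formalised here).
-/

set_option linter.dupNamespace false

namespace Summit.ValiantsHypothesis.ValiantsHypothesis.Cruxes.MonotoneRestorationQP.StrategyCensus

open Summit.ValiantsHypothesis.ValiantsHypothesis.Theses.MonotoneRestoration
open Literature.Computability.AlgebraicComplexity
open Literature.ModelTheory.FiniteModelTheory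

noncomputable section

/-- The complexification used by the route. -/
abbrev φ : NNReal →+* ℂ := Complex.ofRealHom.comp NNReal.toRealHom

/-- Matrix symmetry of a family (hypothesis 1 of the crux). -/
def MatrixSymmetric (f : (n : ℕ) → MvPolynomial (Fin n × Fin n) NNReal) : Prop :=
  ∀ (n : ℕ) (σ τ : Equiv.Perm (Fin n)),
    MvPolynomial.rename (fun p : Fin n × Fin n => (σ p.1, τ p.2)) (f n) = f n

/-- Polynomial degree and polynomial monotone complexity (hypothesis 2 of the crux). -/
def PolyMonotone (f : (n : ℕ) → MvPolynomial (Fin n × Fin n) NNReal) : Prop :=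
  ∃ c : ℕ, ∀ n : ℕ, (f n).totalDegree ≤ (n + 2) ^ c ∧ complexity (k := NNReal) (f n) ≤ (n + 2) ^ c

/-- The conclusion of the crux. -/
def QPSymmetric (f : (n : ℕ) → MvPolynomial (Fin n × Fin n) NNReal) : Prop :=
  ∃ c : ℕ, ∀ n : ℕ, ∃ (G : Type) (_ : Fintype G)
    (C : LabelledArithCircuit ℂ (Fin n × Fin n) Unit G),
    C.IsSymmetric (Equiv.Perm (Fin n)) ∧ C.eval (C.output ()) = MvPolynomial.map φ (f n) ∧
      Fintype.card G ≤ 2 ^ ((Nat.log 2 n + c) ^ c)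

theorem monotoneRestorationQP_iff :
    MonotoneRestorationQP ↔ ∀ f, MatrixSymmetric f → PolyMonotone f → QPSymmetric f :=
  Iff.rfl

/-! ### The gate predicate of line `interval-blocks` -/

/-- `g` is `B`-INTERVAL-BLOCK: invariant under `σ × τ` for all row permutations `σ` preserving a
monotone colouring `κ : Fin n → Fin B` and all column permutations `τ` preserving a monotone
colouring `μ` (the colour classes of a monotone colouring are intervals, so this is invariance
under a Young subgroup `S_{I₁} × ⋯ × S_{I_B}` on rows times one on columns). -/
def IsIntervalBlock (n B : ℕ) (g : MvPolynomial (Fin n × Fin n) NNReal) : Prop :=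
  ∃ κ μ : Fin n → Fin B, Monotone κ ∧ Monotone μ ∧
    ∀ σ τ : Equiv.Perm (Fin n), (∀ x, κ (σ x) = κ x) → (∀ x, μ (τ x) = μ x) →
      MvPolynomial.rename (fun p : Fin n × Fin n => (σ p.1, τ p.2)) g = g

/-- A matrix-symmetric polynomial is `B`-interval-block for every `B ≥ 1` (constant colourings). -/
theorem isIntervalBlock_of_symmetric {n B : ℕ} (hB : 1 ≤ B)
    {g : MvPolynomial (Fin n × Fin n) NNReal}
    (hg : ∀ σ τ : Equiv.Perm (Fin n),
      MvPolynomial.rename (fun p : Fin n × Fin n => (σ p.1, τ p.2)) g = g) :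
    IsIntervalBlock n B g :=
  ⟨fun _ => ⟨0, hB⟩, fun _ => ⟨0, hB⟩, fun _ _ _ => le_rfl, fun _ _ _ => le_rfl,
    fun σ τ _ _ => hg σ τ⟩

/-! ### D2 / N1 — the fooling hinge (typed; NOT a registered line) -/

/-- **Fooling** (card `ck-fooling-lift`'s `MonotoneCkFooling`, typed over the tree's `CkEquiv` and
the adjacency-matrix evaluation of S4 `stub_symmetricLB_of_linearCountingWidth`): for every
monotone exponent `c` there is `c'` such that a matrix-symmetric nonnegative polynomial of degree
and monotone complexity `≤ (n+2)^c` takes equal values at the adjacency matrices of any two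
`C^{(log₂ n + c')^{c'}}`-equivalent graphs on `Fin n`. A NECESSARY condition for the crux (support
theorem at quasi-polynomial orbit size + Anderson–Dawar supports ⇒ counting width), and the typed
target for refuters: ONE monotone-easy separating family refutes it. -/
def Fooling : Prop :=
  ∀ c : ℕ, ∃ c' : ℕ, ∀ (n : ℕ) (f : MvPolynomial (Fin n × Fin n) NNReal),
    (∀ σ τ : Equiv.Perm (Fin n),
      MvPolynomial.rename (fun p : Fin n × Fin n => (σ p.1, τ p.2)) f = f) →
    f.totalDegree ≤ (n + 2) ^ c → complexity (k := NNReal) f ≤ (n + 2) ^ c →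
    ∀ X Y : SimpleGraph (Fin n), CkEquiv ((Nat.log 2 n + c') ^ c') X Y →
      MvPolynomial.eval (Set.indicator {ij : Fin n × Fin n | X.Adj ij.1 ij.2} 1)
          (MvPolynomial.map φ f) =
        MvPolynomial.eval (Set.indicator {ij : Fin n × Fin n | Y.Adj ij.1 ij.2} 1)
          (MvPolynomial.map φ f)

/-- **FooledRestoration**: the crux relativised to families that are fooled at polylog level.
Hypotheses ⊇ the crux's, so `MonotoneRestorationQP → FooledRestoration` trivially; given
`Fooling` it is EQUIVALENT to the crux — the reason the hinge is not registered as a line. -/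
def FooledRestoration : Prop :=
  ∀ f : (n : ℕ) → MvPolynomial (Fin n × Fin n) NNReal, MatrixSymmetric f → PolyMonotone f →
    (∃ c' : ℕ, ∀ (n : ℕ) (X Y : SimpleGraph (Fin n)), CkEquiv ((Nat.log 2 n + c') ^ c') X Y →
      MvPolynomial.eval (Set.indicator {ij : Fin n × Fin n | X.Adj ij.1 ij.2} 1)
          (MvPolynomial.map φ (f n)) =
        MvPolynomial.eval (Set.indicator {ij : Fin n × Fin n | Y.Adj ij.1 ij.2} 1)
          (MvPolynomial.map φ (f n))) →
    QPSymmetric f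

/-- The hinge composes (trivially — which is the costume verdict on its second half). -/
theorem fooling_hinge (hA : Fooling) (hB : FooledRestoration) : MonotoneRestorationQP := by
  intro f hsym hcplx
  obtain ⟨c, hc⟩ := hcplx
  obtain ⟨c', hc'⟩ := hA c
  exact hB f hsym ⟨c, hc⟩ ⟨c', fun n X Y hXY => hc' n (f n) (hsym n) (hc n).1 (hc n).2 X Y hXY⟩

/-- The relativised crux is implied by the crux (extra hypothesis unused). -/
theorem fooledRestoration_of_crux (h : MonotoneRestorationQP) : FooledRestoration :=
  fun f hsym hcplx _ => h f hsym hcplx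

/-! ### S3 — the cancellation-free strengthening and its conjectured witness -/

/-- **MonotoneSymmetricRestorationQP** (strengthening S3 of the census): the crux with the
conclusion strengthened to a CANCELLATION-FREE square-symmetric circuit — a symmetric
`LabelledArithCircuit` over the semiring `ℝ≥0` computing `f n` itself. FALSE on paper (witness
`esymmRowSums` below; STRATEGY-CENSUS.md §S3): restoration must introduce negative constants, so no
proof of the crux can be an induction that stays inside the monotone world. -/
def MonotoneSymmetricRestorationQP : Prop :=
  ∀ f : (n : ℕ) → MvPolynomial (Fin n × Fin n) NNReal, MatrixSymmetric f → PolyMonotone f →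
    ∃ c : ℕ, ∀ n : ℕ, ∃ (G : Type) (_ : Fintype G)
      (C : LabelledArithCircuit NNReal (Fin n × Fin n) Unit G),
      C.IsSymmetric (Equiv.Perm (Fin n)) ∧ C.eval (C.output ()) = f n ∧
        Fintype.card G ≤ 2 ^ ((Nat.log 2 n + c) ^ c)

/-- The conjectured witness against `MonotoneSymmetricRestorationQP`: `e_{⌊n/2⌋}(R₁,…,R_n)` with
`R_i = Σ_j x_ij` — monotone complexity `O(n²)` (prefix dynamic programme), square-symmetric
complexity `O(n²)` over `ℂ` (interpolation `Σ_ρ c_ρ ∏_i (1 + z_ρ R_i)`, negative `c_ρ`), and —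
by the support theorem plus the row-purity of cancellation-free products — no cancellation-free
square-symmetric circuits of orbit size `2^{o(n)}` (paper proof, STRATEGY-CENSUS.md §S3). -/
def esymmRowSums (n : ℕ) : MvPolynomial (Fin n × Fin n) NNReal :=
  ((Finset.univ : Finset (Fin n)).val.map fun i => ∑ j : Fin n, MvPolynomial.X (i, j)).esymm (n / 2)

end

end Summit.ValiantsHypothesis.ValiantsHypothesis.Cruxes.MonotoneRestorationQP.StrategyCensus
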